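import Literature.Combinatorics.Sahi2008.PushForward
import Summits.CriticalPhenomena.PercolationContinuityZ3.Theorems.PercNearOneGluingNoHeavyLowerTailSahiTwoChainWRCoefficients
import Summits.CriticalPhenomena.PercolationContinuityZ3.Theorems.PercNearOneGluingNoHeavyLowerTailSahiSlotPatternPositivity

/-!
# The without-replacement / pattern device at every order `n` and every dimension `d` — VI, THE COLUMN `d ≤ 2` AT EVERY ORDER:
# `SlotPatternPos 2 n` for all `n` (Lieb–Sahi's two-dimensional theorem in the slot normal form), from gen 16's coefficientwise form

Support file of the one-cut programme (crux `NoHeavyLowerTail`, stmt-CriticalPhenomena-4575; cell `prim-masterthm`, seat P3, gen 18;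
`run/shared/lean/prim/prim-masterthm/prim-masterthm-p3/HIERARCHY.md` §26).  Sequel of `…SahiSlotPatternPositivity`; uses gen 16's `…SahiTwoChainWRCoefficients`
(`SahiTwoChain.sahiE_prodWeight_eq_sum_et` — the d = 2 bridge with the recursively defined without-replacement functional `Ẽ_n = SahiTwoChain.et` — and
`SahiTwoChain.et_coef_nonneg`, coefficientwise Lieb–Sahi).

THE ARGUMENT (no identification of `Ẽ_n` with the pattern functional is needed pointwise).  Both bridges express `E_n` under EVERY product weight on `[n]×[n]` as a weighted
sum over slot families `r : Fin 2 → Fin n → Fin n` — gen 16's with kernel `Ẽ_n(h ∘ (r₀×r₁))`, this lane's with kernel `diagForm 2 n (h ∘ slot_r)`.  Taking the product of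
the UNIFORM weights on arbitrary subsets `S₀, S₁ ⊆ [n]` shows that the two kernels have the same sum over the families with values in `S`
(`sum_into_et_sub_diagForm_eq_zero`); inclusion–exclusion over images (`sum_filter_image_eq_zero`, strong induction on `Σ_a #S_a`) extracts the families whose
images are all of `[n]`, i.e. the pairs of PERMUTATIONS (`sum_perm_eq_zero_of_forall_into`): `patternForm 2 n h = Σ_{τ ∈ S_n²} Ẽ_n(h ∘ (τ₀×τ₁))`, every term of which is
`≥ 0` for up-set indicators by `et_coef_nonneg`.  Hence **`slotPatternPos_two_left : ∀ n, SlotPatternPos 2 n`**, `slotPatternPos_of_dim_le_two` (all `d ≤ 2`, all `n`),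
`slotPatternPos_zero_right` (order 0) (the tree's `liebSahiContinuum_two` is then `liebSahiContinuum_of_slotPatternPos` of it).  With `…SahiSlotPatternTwo` (`n = 2`, all `d`) and `…SahiSlotPatternThree` (`(3,3)`) the slot
table is a kernel theorem on `{d ≤ 2} ∪ {n ≤ 2} ∪ {(3,3)}`; `(4,3)` is certified outside the kernel (prim-sahi-p1); `(3,4)` is the first open cell at order 4.
Everything proved; axioms standard. [this work]
-/

noncomputable section

namespace Summit.CriticalPhenomena.PercolationContinuityZ3.Theorems

open Finset Function Equiv Equiv.Perm
open Literature.Combinatorics.Sahi2008 Literature.Combinatorics.Sahi2008.CycleForm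

namespace SahiSlot

/-! ### The column `d = 2`, every order `n`: `SlotPatternPos 2 n` from gen 16's coefficientwise Lieb–Sahi theorem (`SahiTwoChain.et_coef_nonneg`) -/

section TwoDim

open scoped Classical

/-- Order `0` is trivial in every dimension (the empty product: `patternForm d 0 = |S_0^d| ≥ 0`). [this work] -/
theorem slotPatternPos_zero_right (d : ℕ) : SlotPatternPos d 0 := by
  intro U _
  unfold patternForm diagForm
  refine sum_nonneg fun τ _ => sum_nonneg fun σ _ => ?_
  have h0 : (orbits σ).card = 0 := by
    unfold orbits; rw [Finset.univ_eq_empty, image_empty, card_empty]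
  rw [h0]
  norm_num

/-- **Extraction of the surjective part** (inclusion–exclusion over images): if a kernel `K` on slot families `r : A → J → Y` sums to `0` over the families
with values in `S` for EVERY `S : A → Finset Y`, then it sums to `0` over the families whose images are exactly any prescribed `S`. [this work] -/
theorem sum_filter_image_eq_zero {A J Y : Type*} [Fintype A] [DecidableEq A] [Fintype J] [DecidableEq J] [Fintype Y] [DecidableEq Y]
    (K : (A → J → Y) → ℝ)
    (hK : ∀ S : A → Finset Y, ∑ r ∈ univ.filter (fun r : A → J → Y => ∀ a j, r a j ∈ S a), K r = 0) (S₀ : A → Finset Y) :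
    ∑ r ∈ univ.filter (fun r : A → J → Y => (fun a => univ.image (r a)) = S₀), K r = 0 := by
  suffices hmain : ∀ (N : ℕ) (S : A → Finset Y), ∑ a, (S a).card = N →
      ∑ r ∈ univ.filter (fun r : A → J → Y => (fun a => univ.image (r a)) = S), K r = 0 from hmain _ S₀ rfl
  intro N
  induction N using Nat.strong_induction_on with
  | _ N ih =>
  intro S hS
  have hinto : ∀ r : A → J → Y, (∀ a j, r a j ∈ S a) ↔ ∀ a, univ.image (r a) ⊆ S a := by
    intro r
    simp only [Finset.image_subset_iff, mem_univ, true_implies]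
  have hmaps : ∀ r ∈ univ.filter (fun r : A → J → Y => ∀ a j, r a j ∈ S a),
      (fun a => univ.image (r a)) ∈ Fintype.piFinset fun a => (S a).powerset := by
    intro r hr
    rw [mem_filter] at hr
    rw [Fintype.mem_piFinset]
    exact fun a => mem_powerset.2 ((hinto r).1 hr.2 a)
  have hdec := sum_fiberwise_of_maps_to hmaps K
  rw [hK S] at hdec
  have hinner : ∀ T ∈ Fintype.piFinset (fun a => (S a).powerset),
      (∑ r ∈ (univ.filter (fun r : A → J → Y => ∀ a j, r a j ∈ S a)).filter (fun r => (fun a => univ.image (r a)) = T), K r) =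
        ∑ r ∈ univ.filter (fun r : A → J → Y => (fun a => univ.image (r a)) = T), K r := by
    intro T hT
    refine sum_congr ?_ fun _ _ => rfl
    ext r
    simp only [mem_filter, mem_univ, true_and]
    constructor
    · exact fun h => h.2
    · intro h
      refine ⟨(hinto r).2 fun a => ?_, h⟩
      rw [Fintype.mem_piFinset] at hT
      have hra : univ.image (r a) = T a := congrFun h a
      rw [hra]
      exact mem_powerset.1 (hT a)
  rw [sum_congr rfl hinner] at hdec
  have hSmem : S ∈ Fintype.piFinset (fun a => (S a).powerset) := by
    rw [Fintype.mem_piFinset]; exact fun a => mem_powerset.2 subset_rfl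
  rw [← Finset.add_sum_erase _ _ hSmem] at hdec
  have hrest : ∑ T ∈ (Fintype.piFinset fun a => (S a).powerset).erase S,
      ∑ r ∈ univ.filter (fun r : A → J → Y => (fun a => univ.image (r a)) = T), K r = 0 := by
    refine sum_eq_zero fun T hT => ?_
    rw [mem_erase, Fintype.mem_piFinset] at hT
    have hle : ∀ a, T a ⊆ S a := fun a => mem_powerset.1 (hT.2 a)
    obtain ⟨a, ha⟩ : ∃ a, T a ≠ S a := by
      by_contra h
      push Not at h
      exact hT.1 (funext h)
    have hlt : ∑ b, (T b).card < N := by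
      rw [← hS]
      exact sum_lt_sum (fun b _ => card_le_card (hle b)) ⟨a, mem_univ a, card_lt_card ((hle a).ssubset_of_ne ha)⟩
    exact ih _ hlt T rfl
  rw [hrest, add_zero] at hdec
  exact hdec

/-- **The surjective families are the `d`-tuples of permutations**: a kernel that vanishes over families with values in every `S` vanishes when summed
over `τ : Fin d → S_n`. [this work] -/
theorem sum_perm_eq_zero_of_forall_into {d n : ℕ} (K : (Fin d → Fin n → Fin n) → ℝ)
    (hK : ∀ S : Fin d → Finset (Fin n), ∑ r ∈ univ.filter (fun r : Fin d → Fin n → Fin n => ∀ a j, r a j ∈ S a), K r = 0) :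
    ∑ τ : Fin d → Perm (Fin n), K (fun a => ⇑(τ a)) = 0 := by
  have h := sum_filter_image_eq_zero K (fun S => by convert hK S using 3) (fun _ => univ)
  set coeFam : (Fin d → Perm (Fin n)) → (Fin d → Fin n → Fin n) := fun τ a => ⇑(τ a) with hcoe
  have hinj : Function.Injective coeFam := by
    intro τ τ' hττ'
    funext a
    exact Equiv.ext fun j => congrFun (congrFun hττ' a) j
  have himage : univ.image coeFam = univ.filter (fun r : Fin d → Fin n → Fin n => (fun a => univ.image (r a)) = fun _ => univ) := by
    ext r
    simp only [mem_image, mem_univ, true_and, mem_filter]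
    constructor
    · rintro ⟨τ, rfl⟩
      funext a
      exact Finset.image_univ_of_surjective (τ a).surjective
    · intro hr
      have hsurj : ∀ a, Function.Surjective (r a) := fun a y => by
        have hy : y ∈ univ.image (r a) := by rw [congrFun hr a]; exact mem_univ y
        obtain ⟨x, _, hx⟩ := mem_image.1 hy
        exact ⟨x, hx⟩
      refine ⟨fun a => Equiv.ofBijective (r a) ⟨Finite.injective_iff_surjective.2 (hsurj a), hsurj a⟩, ?_⟩
      funext a
      rfl
  calc ∑ τ : Fin d → Perm (Fin n), K (fun a => ⇑(τ a)) = ∑ r ∈ univ.image coeFam, K r :=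
        (sum_image fun τ _ τ' _ hττ' => hinj hττ').symm
    _ = ∑ r ∈ univ.filter (fun r : Fin d → Fin n → Fin n => (fun a => univ.image (r a)) = fun _ => univ), K r := by rw [himage]
    _ = 0 := by convert h using 3

variable {n : ℕ}

/-- The order isomorphism `Fin n × Fin n → (Fin 2 → Fin n)`, `p ↦ (p.1, p.2)` as a function on `Fin 2` (plumbing). [this work] -/
def toQ (p : Fin n × Fin n) : Q 2 n := ![p.1, p.2]

/-- `toQ` composed with the coordinate reading is the identity. [this work] -/
theorem toQ_eval (x : Q 2 n) : toQ (x 0, x 1) = x := by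
  funext a; fin_cases a <;> rfl

/-- **The coefficient kernels of the two bridges agree on families with values in `S`**: for `h : Fin n → [n]² → ℝ` and every `S : Fin 2 → Finset (Fin n)`,
`Σ_{r into S} Ẽ_n(h ∘ toQ ∘ (r₀ × r₁)) = Σ_{r into S} diagForm 2 n (h ∘ slot_r)` — both sides are `Π_a |S_a|^n` times `E_n` under the product of the uniform weights on
`S₀, S₁` (gen 16's bridge `SahiTwoChain.sahiE_prodWeight_eq_sum_et` and `sahiE_gridW_eq_sum_diagForm`). [this work] -/
theorem sum_into_et_sub_diagForm_eq_zero (hn : 1 ≤ n) (h : Fin n → Q 2 n → ℝ) (S : Fin 2 → Finset (Fin n)) :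
    ∑ r ∈ univ.filter (fun r : Fin 2 → Fin n → Fin n => ∀ a j, r a j ∈ S a),
      (SahiTwoChain.et (univ : Finset (Fin n)) (univ : Finset (Fin n)) n (fun i (p : Fin n × Fin n) => h i (toQ (r 0 p.1, r 1 p.2)))
        - diagForm 2 n (fun i => h i ∘ slotMap r)) = 0 := by
  -- empty `S a`: no family maps into `S`
  by_cases hne : ∀ a, (S a).Nonempty
  swap
  · simp only [not_forall, Finset.not_nonempty_iff_eq_empty] at hne
    obtain ⟨a, ha⟩ := hne
    refine sum_eq_zero fun r hr => ?_
    rw [mem_filter] at hr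
    have := hr.2 a ⟨0, hn⟩
    rw [ha] at this
    exact absurd this (Finset.notMem_empty _)
  -- the uniform weights on `S a`
  set g : Fin 2 → Fin n → ℝ := fun a y => if y ∈ S a then ((S a).card : ℝ)⁻¹ else 0 with hg
  have hgsum : ∀ a, ∑ y, g a y = 1 := by
    intro a
    simp only [hg]
    rw [Finset.sum_ite_mem, Finset.univ_inter, sum_const, nsmul_eq_mul, mul_inv_cancel₀]
    exact_mod_cast (hne a).card_pos.ne'
  -- the two bridges compute the same number
  have hpush : pushWeight (gridW g) (fun x : Q 2 n => (x 0, x 1)) = fun p : Fin n × Fin n => g 0 p.1 * g 1 p.2 := by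
    obtain ⟨e, he⟩ : ∃ e : Q 2 n ≃ Fin n × Fin n, ∀ x, e x = (x 0, x 1) :=
      ⟨⟨fun x => (x 0, x 1), toQ, fun x => toQ_eval x, fun p => by rfl⟩, fun x => rfl⟩
    have : (fun x : Q 2 n => (x 0, x 1)) = e := funext fun x => (he x).symm
    rw [this]
    funext p
    rw [pushWeight_equiv]
    have hp : e.symm p = toQ p := by
      apply e.injective; rw [Equiv.apply_symm_apply, he, toQ]; rfl
    rw [hp]
    unfold gridW
    rw [Fin.prod_univ_two]
    rfl
  have hbridge1 := SahiTwoChain.sahiE_prodWeight_eq_sum_et (g 0) (g 1) (hgsum 0) (hgsum 1) n (fun i p => h i (toQ p))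
  have hbridge2 := sahiE_gridW_eq_sum_diagForm g hgsum hn h
  have hsame : sahiE (fun p : Fin n × Fin n => g 0 p.1 * g 1 p.2) n (fun i p => h i (toQ p)) = sahiE (gridW g) n h := by
    rw [← hpush, sahiE_pushWeight]
    congr 1
    funext i x
    simp only [comp_apply, toQ_eval]
  -- rewrite gen 16's double sum over (r, c) as a sum over `r : Fin 2 → Fin n → Fin n`
  have hdouble : ∑ r : Fin n → Fin n, ∑ c : Fin n → Fin n, ((∏ j, g 0 (r j)) * ∏ j, g 1 (c j)) *
      SahiTwoChain.et (univ : Finset (Fin n)) univ n (fun i (p : Fin n × Fin n) => h i (toQ (r p.1, c p.2))) =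
      ∑ r : Fin 2 → Fin n → Fin n, slotW g r *
        SahiTwoChain.et (univ : Finset (Fin n)) univ n (fun i (p : Fin n × Fin n) => h i (toQ (r 0 p.1, r 1 p.2))) := by
    rw [← Fintype.sum_prod_type', ← (piFinTwoEquiv fun _ : Fin 2 => Fin n → Fin n).sum_comp]
    refine Fintype.sum_congr _ _ fun r => ?_
    simp only [piFinTwoEquiv_apply, slotW, Fin.prod_univ_two]
  have hkey : ∑ r : Fin 2 → Fin n → Fin n, slotW g r *
      (SahiTwoChain.et (univ : Finset (Fin n)) univ n (fun i (p : Fin n × Fin n) => h i (toQ (r 0 p.1, r 1 p.2)))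
        - diagForm 2 n (fun i => h i ∘ slotMap r)) = 0 := by
    simp only [mul_sub, sum_sub_distrib]
    rw [← hdouble, ← hbridge1, hsame, hbridge2, sub_self]
  -- the monomial weight is the constant `Π_a |S_a|^{-n}` on families into `S` and `0` elsewhere
  set c : ℝ := ∏ a : Fin 2, (((S a).card : ℝ)⁻¹) ^ n with hc
  have hcpos : 0 < c := prod_pos fun a _ => pow_pos (inv_pos.2 (by exact_mod_cast (hne a).card_pos)) _
  have hin : ∀ r : Fin 2 → Fin n → Fin n, (∀ a j, r a j ∈ S a) → slotW g r = c := by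
    intro r hr
    unfold slotW
    refine prod_congr rfl fun a _ => ?_
    rw [prod_congr rfl fun j _ => show g a (r a j) = ((S a).card : ℝ)⁻¹ by simp [hg, hr a j], prod_const, card_univ, Fintype.card_fin]
  have hout : ∀ r : Fin 2 → Fin n → Fin n, ¬ (∀ a j, r a j ∈ S a) → slotW g r = 0 := by
    intro r hr
    push Not at hr
    obtain ⟨a, j, hj⟩ := hr
    unfold slotW
    exact prod_eq_zero (mem_univ a) (prod_eq_zero (mem_univ j) (by simp [hg, hj]))
  have hw : ∀ r : Fin 2 → Fin n → Fin n, slotW g r = if (∀ a j, r a j ∈ S a) then c else 0 := by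
    intro r
    split_ifs with hr
    · exact hin r hr
    · exact hout r hr
  simp_rw [hw, ite_mul, zero_mul] at hkey
  rw [← sum_filter, ← mul_sum] at hkey
  exact (mul_eq_zero.1 hkey).resolve_left hcpos.ne'

/-- **`SlotPatternPos 2 n` for every `n`** — the column `d = 2` of the slot table (Lieb–Sahi's theorem in slot normal form): the symmetrising sum of the pattern functional
equals the symmetrising sum of gen 16's without-replacement coefficients `Ẽ_n` (surjective extraction), and each of those is `≥ 0` by `SahiTwoChain.et_coef_nonneg`. [this work] -/
theorem slotPatternPos_two_left (n : ℕ) : SlotPatternPos 2 n := by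
  rcases Nat.eq_zero_or_pos n with rfl | hn
  · exact slotPatternPos_zero_right 2
  intro U hU
  set h : Fin n → Q 2 n → ℝ := fun i => setInd (U i) with hh
  have hext := sum_perm_eq_zero_of_forall_into (d := 2)
    (fun r => SahiTwoChain.et (univ : Finset (Fin n)) univ n (fun i (p : Fin n × Fin n) => h i (toQ (r 0 p.1, r 1 p.2)))
      - diagForm 2 n (fun i => h i ∘ slotMap r))
    (fun S => sum_into_et_sub_diagForm_eq_zero hn h S)
  simp only [sum_sub_distrib, sub_eq_zero] at hext
  -- `patternForm = Σ_τ diagForm (h ∘ act τ)`, and `slotMap (fun a => ⇑(τ a)) = act τ`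
  have hpat : patternForm 2 n h = ∑ τ : Fin 2 → Perm (Fin n), diagForm 2 n (fun i => h i ∘ slotMap fun a => ⇑(τ a)) := rfl
  rw [hpat, ← hext]
  refine sum_nonneg fun τ _ => ?_
  -- monotone nonnegative family on `Fin n × Fin n`
  have hmono : ∀ i, Monotone fun p : Fin n × Fin n => h i (toQ p) := by
    intro i p q hpq
    refine monotone_setInd (hU i) ?_
    intro a; fin_cases a
    · exact hpq.1
    · exact hpq.2
  exact SahiTwoChain.et_coef_nonneg (fun i (p : Fin n × Fin n) => h i (toQ p)) (fun i p => setInd_nonneg _ _) hmono (τ 0) (τ 1)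

/-- **Every cell with `d ≤ 2`**: `SlotPatternPos d n` for all `n` and `d ≤ 2` (antitonicity in the dimension). [this work] -/
theorem slotPatternPos_of_dim_le_two {d : ℕ} (hd : d ≤ 2) (n : ℕ) : SlotPatternPos d n := (slotPatternPos_two_left n).of_le hd

end TwoDim

end SahiSlot

end Summit.CriticalPhenomena.PercolationContinuityZ3.Theorems
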